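import Literature.NumberTheory.LFunctions.Zhang2022.RepairGapSection9GatheringPremise
import Literature.NumberTheory.LFunctions.Zhang2022.RepairGapSection8FrontEnd82Premise
import Literature.NumberTheory.LFunctions.Zhang2022.RepairGapLemma84LeafUnconditional
import HarnessLib

/-!
# Zhang (2022), rescue GAP/BED (D-0124 (3)(4)): §8 p. 47 — the gathering display Z22:§8.u044 («`S_j(𝐚₁₁,𝐚₂₁) = L′(1,χ)²Σ…
# + o(α)`», `Section8cStatements.Step8u044`) under the minimum premise `‖L(1,χ)‖ ≤ 𝓛⁻¹⁵`, UNCONDITIONAL for `c′ ≥ 0`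

Topic `Literature/NumberTheory/LFunctions/Zhang2022` (Landau–Siegel audit tree; verdict-neutral).
Y. Zhang, *Discrete mean estimates and the Landau–Siegel zero*, arXiv:2211.02515v1 (2022)
[Zhang2022LandauSiegel] — **an unrefereed manuscript under adjudication; nothing in this file asserts or
denies its Theorems 1–2, and nothing here is a claim about Landau–Siegel zeros. The programme SEARCHES and
TYPES; no claim about Landau–Siegel zeros, Theorems 1–2 of arXiv:2211.02515 or a repaired Margin232 until a
kernel theorem says so.**

The tree derives the §8 gathering display `Section8cStatements.Step8u044 c′` («Gathering these results together we conclude, by simple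
approximation, that …», §8 p. 47 tex L2436; the head of the main-term chain u044 → (8.10) → u046 → (8.11) → (8.12) feeding the (8.23)
evaluation) by `Section8FrontEnd44ReductionRel.step8u044_of_rel` from §8.u040/u041 (Lemma 8.2 at `P₁/dr`, `P₂/dr`), the RELATIVE twins of
§8.u042/u043 (Lemma 8.4 at `P₁/dr`, `P₂/dr`) and the hypothesis-free `ξ₀`-tail mean, through the guard-free core `coreRel`; Assumption (A)
is only THREADED into those four inputs, all kernel at (A)-exponent 15 (`Section8FrontEnd82.step8u040_pow15` / `step8u041_pow15` p613435;
`u043R_pow15W` p618161; `Skeleton.lemma84Rel_pow15` p608375 — bed-2 g6). This file adds the missing relative twin **`u042R_pow15W`** (tree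
`u042R_of_lemma84W` verbatim, guard swapped; `μ = 6`, `y = P₁/dr`) and re-runs the gathering edge VERBATIM with the guard text
`AssumptionA D χ →` replaced by `‖L(1,χ)‖ ≤ 𝓛⁻¹⁵ →` (`step8u044_pow15_of_rel`), whence **`step8u044_pow15` — the body of `Step8u044 c′` at
guard `𝓛⁻¹⁵`, every `c′ ≥ 0`, UNCONDITIONAL** (and `step8u044_of_assumptionAWith`, every real `E ≥ 15`). Theorems only; no definition, no
named fact; nothing about (A) itself.

## References

* Y. Zhang, arXiv:2211.02515v1 (2022), §8 p. 47 (tex L2429–L2437); Lemma 8.2 p. 44; Lemma 8.4 p. 46. [cite: Zhang2022LandauSiegel, §8 p. 47]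
-/

noncomputable section

open Complex Real ComplexConjugate Finset

namespace Literature.NumberTheory.LFunctions.Zhang2022.Section8FrontEnd44ReductionRel

open Literature.NumberTheory.LFunctions.Zhang2022.Skeleton
open Literature.NumberTheory.LFunctions.Zhang2022.Section8FrontEnd82
open Literature.NumberTheory.LFunctions.Zhang2022.Section8FrontEnd84
open Literature.NumberTheory.LFunctions.Zhang2022.Section8FrontEnd44Sizes
open Literature.NumberTheory.LFunctions.Zhang2022.Section8FrontEnd44Reduction
open Literature.NumberTheory.LFunctions.Zhang2022.Section8cStatements (arithW mFac nFac diagFac)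

/-- **`Z22:§8.u042` with an error weight `W(dr)` ⇐ the Lemma 8.4 display with the same weight, BOTH GUARDED BY `‖L(1,χ)‖ ≤ 𝓛⁻¹⁵`** (twin of
`u042R_of_lemma84W`, proof verbatim; `μ = 6`, `y = P₁/dr`, constant `2|C|`). [cite: Zhang2022LandauSiegel, §8 p.47, tex L2429] -/
theorem u042R_pow15W (c' : ℝ) {W : ℕ → ℝ} (hW : ∀ n, 0 ≤ W n)
    (h84 : ∃ C : ℝ, ForAllLarge fun D _ χ => ‖χ.LFunction 1‖ ≤ 1 / Real.log D ^ 15 →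
      ∀ j ∈ ({1, 2, 3} : Finset ℕ), ∀ μ ∈ ({6, 7} : Finset ℕ), ∀ d r : ℕ, 1 ≤ d → 1 ≤ r →
        ((d * r : ℕ) : ℝ) < bigP D / bigT D ^ 2 → ∀ y : ℝ, bigT D < y → y < bigP D →
          ‖(∑ n ∈ Finset.Ico 1 ⌈y⌉₊, χ (n : ZMod D) * xiZero c' D j n d r / (n : ℂ) *
                ((y / n : ℝ) : ℂ) ^ (-betaMu D μ) * (Real.log (y / n) : ℂ)) -
              deriv χ.LFunction 1 * PiW χ d r * frakgW c' D j μ y‖ ≤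
            C * (ell D ^ 6)⁻¹ * W (d * r)) :
    ∃ C : ℝ, ForAllLarge fun D _ χ => ‖χ.LFunction 1‖ ≤ 1 / Real.log D ^ 15 →
      ∀ j ∈ ({1, 2, 3} : Finset ℕ), ∀ d r : ℕ, 1 ≤ d → 1 ≤ r →
        ((d * r : ℕ) : ℝ) < Skeleton.P1 D / bigT D →
          ‖(∑ n ∈ Finset.Ico 1 (Nsupp D),
                χ (n : ZMod D) * conj (vk1 D (d * r * n)) * xiZero c' D j n d r / (n : ℂ)) -
              deriv χ.LFunction 1 * PiW χ d r / (Real.log (Skeleton.P1 D) : ℂ) *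
                frakgW c' D j 6 (Skeleton.P1 D / ((d * r : ℕ) : ℝ))‖ ≤
            C * (ell D ^ 15)⁻¹ * W (d * r) := by
  obtain ⟨C, D₀, h⟩ := h84
  refine ⟨2 * |C|, max D₀ ⌈Real.exp 2⌉₊, fun D _ χ hD hq hp hA j hj d r hd hr hdr => ?_⟩
  have hD₀ : D₀ ≤ D := le_trans (le_max_left _ _) hD
  have hL : 2 ≤ ell D := two_le_ell (le_trans (le_max_right _ _) hD)
  obtain ⟨hlogP1, -, hP1PT, -, hP1T, -, hP1P, -⟩ := params hL
  have hL0 : 0 < ell D := by linarith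
  have hT0 : 0 < bigT D := Real.exp_pos _
  have hdr1 : 1 ≤ d * r := Nat.one_le_iff_ne_zero.mpr (Nat.mul_ne_zero (by omega) (by omega))
  have hdr0 : (0 : ℝ) < ((d * r : ℕ) : ℝ) := by exact_mod_cast hdr1
  set x : ℝ := Skeleton.P1 D / ((d * r : ℕ) : ℝ) with hx
  have hP1x : Skeleton.P1 D = ((d * r : ℕ) : ℝ) * x := by rw [hx]; field_simp
  have hxT : bigT D < x := by
    rw [hx, lt_div_iff₀ hdr0]; rw [lt_div_iff₀ hT0] at hdr; linarith
  have hP1pos : 0 < Skeleton.P1 D := Real.rpow_pos_of_pos (Real.exp_pos _) _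
  have hxle : x ≤ Skeleton.P1 D := div_le_self hP1pos.le (by exact_mod_cast hdr1)
  have hxP : x < bigP D := lt_of_le_of_lt hxle hP1P
  have hT1 : 1 < bigT D := by
    rw [bigT]; exact Real.one_lt_exp_iff.mpr (by positivity)
  have hP1one : 1 < Skeleton.P1 D := lt_of_lt_of_le (lt_trans hT1 hxT) hxle
  have hdrPT : ((d * r : ℕ) : ℝ) < bigP D / bigT D ^ 2 := by
    have : Skeleton.P1 D / bigT D ≤ bigP D / bigT D ^ 2 := by
      rw [div_le_div_iff₀ hT0 (by positivity)]; nlinarith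
    exact lt_of_lt_of_le hdr this
  have key := h D χ hD₀ hq hp hA j hj 6 (by simp) d r hd hr hdrPT x hxT hxP
  have hWdr : 0 ≤ W (d * r) := hW _
  have key' : ‖(∑ n ∈ Finset.Ico 1 ⌈x⌉₊, χ (n : ZMod D) * xiZero c' D j n d r / (n : ℂ) *
        ((x / n : ℝ) : ℂ) ^ (-betaMu D 6) * (Real.log (x / n) : ℂ)) -
          deriv χ.LFunction 1 * PiW χ d r * frakgW c' D j 6 x‖ ≤
      |C| * (ell D ^ 6)⁻¹ * W (d * r) := by
    refine key.trans ?_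
    have hℓ : 0 ≤ (ell D ^ 6)⁻¹ := by positivity
    gcongr
    exact le_abs_self _
  have hsub : Finset.Ico 1 ⌈x⌉₊ ⊆ Finset.Ico 1 (Nsupp D) := Ico_ceil_subset hP1PT hdr1
  have hsum : (∑ n ∈ Finset.Ico 1 (Nsupp D),
        χ (n : ZMod D) * conj (vk1 D (d * r * n)) * xiZero c' D j n d r / (n : ℂ)) =
      (1 / (Real.log (Skeleton.P1 D) : ℂ)) *
        ∑ n ∈ Finset.Ico 1 ⌈x⌉₊, χ (n : ZMod D) * xiZero c' D j n d r / (n : ℂ) *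
          ((x / n : ℝ) : ℂ) ^ (-betaMu D 6) * (Real.log (x / n) : ℂ) := by
    rw [Finset.mul_sum]
    symm
    apply Finset.sum_subset_zero_on_sdiff hsub
    · intro n hn
      rw [Finset.mem_sdiff, Finset.mem_Ico, Finset.mem_Ico, not_and, not_lt] at hn
      have hxn : x ≤ n := Nat.ceil_le.mp (hn.2 hn.1.1)
      have : Skeleton.P1 D ≤ ((d * r * n : ℕ) : ℝ) := by
        rw [hP1x]; push_cast
        exact mul_le_mul_of_nonneg_left hxn (by positivity)
      rw [vk1_mul_eq_zero this, map_zero, mul_zero, zero_mul, zero_div]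
    · intro n hn
      rw [Finset.mem_Ico] at hn
      have hn1 : 1 ≤ n := hn.1
      have hnx : (n : ℝ) < x := Nat.lt_ceil.mp hn.2
      have hn0 : (0 : ℝ) < n := by exact_mod_cast hn1
      have hdrn : ((d * r * n : ℕ) : ℝ) < Skeleton.P1 D := by
        rw [hP1x]; push_cast
        have := mul_lt_mul_of_pos_left hnx hdr0
        push_cast at this; linarith
      rw [conj_vk1_mul_eq hP1one hdr1 hn1 hdrn]
      have hb : betaMu D 6 = beta6 D := by simp [betaMu]
      rw [hb, show Skeleton.P1 D / ((d * r : ℕ) : ℝ) / n = x / n by rw [hx]]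
      ring
  have hlog0 : 0 < Real.log (Skeleton.P1 D) := by rw [hlogP1]; positivity
  rw [hsum, show (1 / (Real.log (Skeleton.P1 D) : ℂ)) *
        (∑ n ∈ Finset.Ico 1 ⌈x⌉₊, χ (n : ZMod D) * xiZero c' D j n d r / (n : ℂ) *
          ((x / n : ℝ) : ℂ) ^ (-betaMu D 6) * (Real.log (x / n) : ℂ)) -
        deriv χ.LFunction 1 * PiW χ d r / (Real.log (Skeleton.P1 D) : ℂ) * frakgW c' D j 6 x =
      (1 / (Real.log (Skeleton.P1 D) : ℂ)) *
        ((∑ n ∈ Finset.Ico 1 ⌈x⌉₊, χ (n : ZMod D) * xiZero c' D j n d r / (n : ℂ) *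
          ((x / n : ℝ) : ℂ) ^ (-betaMu D 6) * (Real.log (x / n) : ℂ)) -
          deriv χ.LFunction 1 * PiW χ d r * frakgW c' D j 6 x) by ring, norm_mul]
  have hn : ‖(1 / (Real.log (Skeleton.P1 D) : ℂ))‖ = 1 / Real.log (Skeleton.P1 D) := by
    rw [norm_div, norm_one, Complex.norm_real, Real.norm_eq_abs, abs_of_pos hlog0]
  rw [hn]
  have hC0 : 0 ≤ |C| := abs_nonneg _
  calc 1 / Real.log (Skeleton.P1 D) * ‖(∑ n ∈ Finset.Ico 1 ⌈x⌉₊,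
          χ (n : ZMod D) * xiZero c' D j n d r / (n : ℂ) * ((x / n : ℝ) : ℂ) ^ (-betaMu D 6) *
            (Real.log (x / n) : ℂ)) - deriv χ.LFunction 1 * PiW χ d r * frakgW c' D j 6 x‖
      ≤ 1 / Real.log (Skeleton.P1 D) * (|C| * (ell D ^ 6)⁻¹ * W (d * r)) :=
        mul_le_mul_of_nonneg_left key' (by positivity)
    _ = |C| / 0.504 * (ell D ^ 15)⁻¹ * W (d * r) := by rw [hlogP1]; field_simp
    _ ≤ 2 * |C| * (ell D ^ 15)⁻¹ * W (d * r) := by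
        apply mul_le_mul_of_nonneg_right _ hWdr
        apply mul_le_mul_of_nonneg_right _ (by positivity)
        rw [div_le_iff₀ (by norm_num)]; nlinarith

/-- **The gathering display Z22:§8.u044 as an edge at (A)-exponent 15** (twin of `step8u044_of_rel`, proof verbatim with
`step8u040_pow15` / `step8u041_pow15` for `step8u040_holds` / `step8u041_holds`): from the relative twins of §8.u042/u043 at guard `𝓛⁻¹⁵` to
the body of `Step8u044 c′` at guard `𝓛⁻¹⁵`. [cite: Zhang2022LandauSiegel, §8 display before (8.10) p.47, tex L2436] -/
theorem step8u044_pow15_of_rel {c' : ℝ} (hc' : 0 ≤ c')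
    (h42 : ∃ C : ℝ, ForAllLarge fun D _ χ => ‖χ.LFunction 1‖ ≤ 1 / Real.log D ^ 15 →
      ∀ j ∈ ({1, 2, 3} : Finset ℕ), ∀ d r : ℕ, 1 ≤ d → 1 ≤ r →
        ((d * r : ℕ) : ℝ) < Skeleton.P1 D / bigT D →
          ‖(∑ n ∈ Finset.Ico 1 (Nsupp D),
                χ (n : ZMod D) * conj (vk1 D (d * r * n)) * xiZero c' D j n d r / (n : ℂ)) -
              deriv χ.LFunction 1 * PiW χ d r / (Real.log (Skeleton.P1 D) : ℂ) *
                frakgW c' D j 6 (Skeleton.P1 D / ((d * r : ℕ) : ℝ))‖ ≤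
            C * (ell D ^ 15)⁻¹ * (∏ q ∈ (d * r).primeFactors, (1 - (q : ℝ)⁻¹)⁻¹) ^ 2)
    (h43 : ∃ C : ℝ, ForAllLarge fun D _ χ => ‖χ.LFunction 1‖ ≤ 1 / Real.log D ^ 15 →
      ∀ j ∈ ({1, 2, 3} : Finset ℕ), ∀ d r : ℕ, 1 ≤ d → 1 ≤ r →
        ((d * r : ℕ) : ℝ) < Skeleton.P2 D / bigT D →
          ‖(∑ n ∈ Finset.Ico 1 (Nsupp D),
                χ (n : ZMod D) * conj (vk2 D (d * r * n)) * xiZero c' D j n d r / (n : ℂ)) -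
              deriv χ.LFunction 1 * PiW χ d r / (Real.log (Skeleton.P2 D) : ℂ) *
                frakgW c' D j 7 (Skeleton.P2 D / ((d * r : ℕ) : ℝ))‖ ≤
            C * (ell D ^ 15)⁻¹ * (∏ q ∈ (d * r).primeFactors, (1 - (q : ℝ)⁻¹)⁻¹) ^ 2) :
    ∀ ε : ℝ, 0 < ε → ForAllLarge fun D _ χ => ‖χ.LFunction 1‖ ≤ 1 / Real.log D ^ 15 →
      ∀ j ∈ ({1, 2, 3} : Finset ℕ),
        ‖Sj c' D j (a11 χ) (a21 χ) -
            (deriv χ.LFunction 1 ^ 2 *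
                (∑ n ∈ Finset.Ico 1 ⌈Skeleton.P2 D⌉₊, ∑ p ∈ Nat.divisorsAntidiagonal n,
                  arithW c' χ j p.1 p.2 * (mFac c' D j n * nFac c' D j n)) +
              deriv χ.LFunction 1 ^ 2 *
                (∑ n ∈ Finset.Ico ⌈Skeleton.P2 D⌉₊ ⌈Skeleton.P1 D⌉₊, ∑ p ∈ Nat.divisorsAntidiagonal n,
                  arithW c' χ j p.1 p.2 * diagFac c' D j n))‖
          ≤ ε * alpha D := by
  intro ε hε
  obtain ⟨C40, D40, h40⟩ := step8u040_pow15 hc'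
  obtain ⟨C41, D41, h41⟩ := step8u041_pow15 hc'
  obtain ⟨C42, D42, h42⟩ := h42
  obtain ⟨C43, D43, h43⟩ := h43
  obtain ⟨Cξ, Dξ, hξ⟩ := XiZeroMajorant.xiZeroTailMean c'
  set C₁ : ℝ := max (max |C40| |C41|) (max |C42| |C43|) with hC₁def
  have h40le : |C40| ≤ C₁ := le_trans (le_max_left _ _) (le_max_left _ _)
  have h41le : |C41| ≤ C₁ := le_trans (le_max_right _ _) (le_max_left _ _)
  have h42le : |C42| ≤ C₁ := le_trans (le_max_left _ _) (le_max_right _ _)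
  have h43le : |C43| ≤ C₁ := le_trans (le_max_right _ _) (le_max_right _ _)
  have hC₁ : 0 ≤ C₁ := (abs_nonneg C40).trans h40le
  set C₂ : ℝ := max Cξ 0 with hC₂def
  have hC₂ : 0 ≤ C₂ := le_max_right _ _
  obtain ⟨K, hK0, hcore⟩ := coreRel c' hC₁ hC₂
  set Dfin : ℕ := ⌈Real.exp (K ^ 10 / (ε * π) ^ 10)⌉₊ with hDfin
  refine ⟨max (max (max D40 D41) (max D42 D43)) (max Dξ (max ⌈Real.exp 3⌉₊ Dfin)),
    fun D _ χ hD hq hp hA j hj => ?_⟩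
  have hD40 : D40 ≤ D := le_trans (le_trans (le_max_left _ _) (le_max_left _ _)) (le_trans (le_max_left _ _) hD)
  have hD41 : D41 ≤ D := le_trans (le_trans (le_max_right _ _) (le_max_left _ _)) (le_trans (le_max_left _ _) hD)
  have hD42 : D42 ≤ D := le_trans (le_trans (le_max_left _ _) (le_max_right _ _)) (le_trans (le_max_left _ _) hD)
  have hD43 : D43 ≤ D := le_trans (le_trans (le_max_right _ _) (le_max_right _ _)) (le_trans (le_max_left _ _) hD)
  have hDξ : Dξ ≤ D := le_trans (le_max_left _ _) (le_trans (le_max_right _ _) hD)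
  have hD3 : ⌈Real.exp 3⌉₊ ≤ D :=
    le_trans (le_trans (le_max_left _ _) (le_max_right _ _)) (le_trans (le_max_right _ _) hD)
  have hDf : Dfin ≤ D :=
    le_trans (le_trans (le_max_right _ _) (le_max_right _ _)) (le_trans (le_max_right _ _) hD)
  have hL3 : 3 ≤ ell D := three_le_ell hD3
  have hL1 : 1 ≤ ell D := by linarith
  have hL0 : 0 < ell D := by linarith
  have hinv : ∀ {C : ℝ}, |C| ≤ C₁ → C * (ell D ^ 15)⁻¹ ≤ C₁ / ell D ^ 15 := by
    intro C hC
    rw [div_eq_mul_inv]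
    exact mul_le_mul_of_nonneg_right ((le_abs_self C).trans hC) (by positivity)
  have hinvR : ∀ {C R : ℝ}, |C| ≤ C₁ → 0 ≤ R →
      C * (ell D ^ 15)⁻¹ * R ≤ C₁ / ell D ^ 15 * R := by
    intro C R hC hR
    exact mul_le_mul_of_nonneg_right (hinv hC) hR
  have key := hcore hq hp hD3 j
    (fun d r hd hr hdr => (h40 D χ hD40 hq hp hA j hj d r hd hr hdr).trans (hinv h40le))
    (fun d r hd hr hdr => (h41 D χ hD41 hq hp hA j hj d r hd hr hdr).trans (hinv h41le))
    (fun d r hd hr hdr =>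
      (h42 D χ hD42 hq hp hA j hj d r hd hr hdr).trans (hinvR h42le (sq_nonneg _)))
    (fun d r hd hr hdr =>
      (h43 D χ hD43 hq hp hA j hj d r hd hr hdr).trans (hinvR h43le (sq_nonneg _)))
    (fun d r hd hr hdr x hx1 hxT =>
      (hξ D χ hDξ hq hp j hj d r hd hr hdr x hx1 hxT).trans
        (mul_le_mul_of_nonneg_right (mul_le_mul_of_nonneg_right (le_max_left _ _) hL0.le)
          (pow_nonneg (by linarith [Real.log_nonneg hx1]) 3)))
  have hLK : K ^ 10 / (ε * π) ^ 10 ≤ ell D := by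
    have hexp : Real.exp (K ^ 10 / (ε * π) ^ 10) ≤ D :=
      le_trans (Nat.le_ceil _) (by exact_mod_cast hDf)
    exact (Real.le_log_iff_exp_le (lt_of_lt_of_le (Real.exp_pos _) hexp)).mpr hexp
  calc _ ≤ K * (ell D ^ (1.1 : ℝ)) ^ 7 / ell D ^ 17 := key
    _ ≤ ε * π / ell D ^ 9 := final_small (by positivity) hL1 hLK
    _ = ε * alpha D := by rw [Section2.alpha_eq_pi_div_ell9]; ring

/-- **Z22:§8.u044 at (A)-exponent 15, UNCONDITIONAL, every `c′ ≥ 0`** — the body of `Section8cStatements.Step8u044 c′` with its guard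
`AssumptionA D χ` replaced by `‖L(1,χ)‖ ≤ 𝓛⁻¹⁵`: `step8u044_pow15_of_rel` at `u042R_pow15W` / `u043R_pow15W` over `Skeleton.lemma84Rel_pow15`
(`W(n) = (∏_{q∣n}(1−q⁻¹)⁻¹)²`). [cite: Zhang2022LandauSiegel, §8 display before (8.10) p.47, tex L2436] -/
theorem step8u044_pow15 {c' : ℝ} (hc' : 0 ≤ c') :
    ∀ ε : ℝ, 0 < ε → ForAllLarge fun D _ χ => ‖χ.LFunction 1‖ ≤ 1 / Real.log D ^ 15 →
      ∀ j ∈ ({1, 2, 3} : Finset ℕ),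
        ‖Sj c' D j (a11 χ) (a21 χ) -
            (deriv χ.LFunction 1 ^ 2 *
                (∑ n ∈ Finset.Ico 1 ⌈Skeleton.P2 D⌉₊, ∑ p ∈ Nat.divisorsAntidiagonal n,
                  arithW c' χ j p.1 p.2 * (mFac c' D j n * nFac c' D j n)) +
              deriv χ.LFunction 1 ^ 2 *
                (∑ n ∈ Finset.Ico ⌈Skeleton.P2 D⌉₊ ⌈Skeleton.P1 D⌉₊, ∑ p ∈ Nat.divisorsAntidiagonal n,
                  arithW c' χ j p.1 p.2 * diagFac c' D j n))‖
          ≤ ε * alpha D :=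
  step8u044_pow15_of_rel hc'
    (u042R_pow15W c' (W := fun n => (∏ q ∈ n.primeFactors, (1 - (q : ℝ)⁻¹)⁻¹) ^ 2)
      (fun _ => sq_nonneg _) (lemma84Rel_pow15 c'))
    (u043R_pow15W c' (W := fun n => (∏ q ∈ n.primeFactors, (1 - (q : ℝ)⁻¹)⁻¹) ^ 2)
      (fun _ => sq_nonneg _) (lemma84Rel_pow15 c'))

/-- **Z22:§8.u044 under `Repair.Bed.AssumptionAWith E`, every real `E ≥ 15`** (transfer of `step8u044_pow15`; at `E = 2022` the body of the
tree theorem `step8u044_of_lemma84Rel hc′ (Skeleton.lemma84Rel_holds c′)`). [cite: Zhang2022LandauSiegel, §8 p.47] -/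
theorem step8u044_of_assumptionAWith {c' : ℝ} (hc' : 0 ≤ c') {E : ℝ} (hE : 15 ≤ E) :
    ∀ ε : ℝ, 0 < ε → ForAllLarge fun D _ χ => Repair.Bed.AssumptionAWith E D χ →
      ∀ j ∈ ({1, 2, 3} : Finset ℕ),
        ‖Sj c' D j (a11 χ) (a21 χ) -
            (deriv χ.LFunction 1 ^ 2 *
                (∑ n ∈ Finset.Ico 1 ⌈Skeleton.P2 D⌉₊, ∑ p ∈ Nat.divisorsAntidiagonal n,
                  arithW c' χ j p.1 p.2 * (mFac c' D j n * nFac c' D j n)) +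
              deriv χ.LFunction 1 ^ 2 *
                (∑ n ∈ Finset.Ico ⌈Skeleton.P2 D⌉₊ ⌈Skeleton.P1 D⌉₊, ∑ p ∈ Nat.divisorsAntidiagonal n,
                  arithW c' χ j p.1 p.2 * diagFac c' D j n))‖
          ≤ ε * alpha D :=
  fun ε hε => Repair.Gap.forAllLarge_assumptionAWith_of_pow15 hE (step8u044_pow15 hc' ε hε)

end Literature.NumberTheory.LFunctions.Zhang2022.Section8FrontEnd44ReductionRel

end
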